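/-
Copyright (c) 2026 the pub-hodgecm-mathlib formalisation cell (harness21).  Prover seat hodgecm-mathlib-A-p03 (g24); LEAD F0P3a-plan (g9) WORD T8-24 (1)(ii)
«(ii′)-TRANSPORT» (= F0P3a-p03 (g10)'s census head (B1)), 2026-09-01.
-/
import Literature.NumberTheory.Automorphic.ConjugationProperOnRegularCompacta      -- ★ p840074 (ii′): `UnitaryGroupOfForm.isCompact_image_mk_setOf_exists_conj_mem_of_charpoly_separable`
import Literature.NumberTheory.Automorphic.OrbitalMeasureCanonicalExistsCM          -- ★ bridge `charpoly_separable_localNonsplitEquiv_of_isRegularElt`; brings ★ `localNonsplitEquiv`, `«local»`, `cmDatum`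
import Literature.NumberTheory.Automorphic.UnitaryGroupInertPlaceHyperbolicBasis    -- ★ `galAdicCompletionMap_galAdicCompletionMap_of_smul_eq`, ★ `placeForm_hermitian_of_smul_eq`
import Literature.MeasureTheory.Group.InvariantQuotientOrbitalTransport             -- ★ `cosetCongr` ∕ `cosetCongrHomeomorph`, ★ `forall_apply_mem_centralizer_singleton_iff_of_eq`
import HarnessLib

/-!
# Harish-Chandra's uniform compactness (ii′) TRANSPORTED to the local unitary groups `U(J)(F_v)` at a non-split place

Topic `NumberTheory/Automorphic`; namespaces `Literature.NumberTheory.Automorphic` (§1) and `Literature.NumberTheory.Automorphic.UnitaryGroup` (§2).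
THEOREMS ONLY (no definition, no instance, no notation, no named fact, no `sorry`).  Cell `pub/hodgecm-mathlib`, ENGINE T1 (crux H413 =
`stmt-HodgeConjecture-24833`), road «N6-ns»; LEAD F0P3a-plan (g9) WORD T8-24 (1)(ii): the rider that lands ★ p840074's `U(σ, J)(E)`-level head
`UnitaryGroupOfForm.isCompact_image_mk_setOf_exists_conj_mem_of_charpoly_separable` at the tree's local unitary groups `«local» E c N J v`
(= `(cmDatum L N H).Local v` for a CM field, definitionally) BY NAME, through the one-place model ★ `localNonsplitEquiv : U(J)(F_v) ≃ₜ* U(σ_w, J_w)(E_w)`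
at a place `w ∣ v` with `c • w = w`.  This is F0P3a-p03 (g10)'s census head (B1) of `CENSUS-N6ns-ii-CMdress` (47bf244c), delivered as an importable file
so that his FILE B (the torus form (B2) of the local constancy) takes `hE` from here.

* §1 generic transport along a group isomorphism `e : G ≃* G'` that is a homeomorphism: `image_setOf_exists_conj_mem_mulEquiv`
  (`e '' {x ∣ ∃ t ∈ K, x t x⁻¹ ∈ C} = {x' ∣ ∃ t' ∈ e K, x' t' x'⁻¹ ∈ e C}`), `image_mk_setOf_exists_conj_mem_eq_image_cosetCongr` (the images in `G ⧸ H`,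
  `G' ⧸ H'` correspond under ★ `cosetCongr e`), **`isCompact_image_mk_setOf_exists_conj_mem_of_mulEquiv`** (compactness pulls back along ★ `cosetCongrHomeomorph`);
* §2 **`UnitaryGroup.isCompact_image_mk_setOf_exists_conj_mem_local_of_nonsplit`** — for `γ ∈ U(J)(F_v)` regular semisimple (`IsRegularElt` of its
  `GL_N(E ⊗ F_v)`-matrix), a compact `K ⊆ Z(γ)` of regular semisimple elements and a compact `C`: `{ẋ ∈ U(J)(F_v) ⧸ Z(γ) ∣ ∃ t ∈ K, x t x⁻¹ ∈ C}` is
  COMPACT (instances pinned as in ★ `CompactCoreCentralizerNonarch`: `E_w` read as a complete non-trivially normed field via Mathlib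
  `Valued.toNontriviallyNormedField`; `GL_N(E_w)` σ-compact from locally compact + second countable; `(2 : E_w) ≠ 0` by characteristic zero;
  `σ_w` a continuous involution ★ `continuous_galAdicCompletionMap` ∕ ★ `galAdicCompletionMap_galAdicCompletionMap_of_smul_eq`; `J_w` hermitian with unit
  determinant ★ `placeForm_hermitian_of_smul_eq` ∕ ★ `isUnit_placeForm_of_isUnit_det`; regularity bridge ★ `charpoly_separable_localNonsplitEquiv_of_isRegularElt`);
  the CM spelling `UnitaryGroup.isCompact_image_mk_setOf_exists_conj_mem_cmDatum_local` and the consumer's reading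
  `UnitaryGroup.exists_isCompact_forall_support_descConj_subset_local_of_nonsplit` (ONE compact set of `U(J)(F_v) ⧸ Z(γ)` carrying the supports of all
  orbital integrands `ẋ ↦ f(x t x⁻¹)`, `t ∈ K`, `support f ⊆ C`).
NOT HERE: split places (★ `GL.isCompact_image_mk_…` through ★ `localSplitEquiv` — the D-N6s road is closed; on a consumer's word only); the local constancy
itself (F0P3a-p03 (g10) FILE A∕B).  HONEST LABEL: HC_CM is proved only modulo the printed citations until rung 0 closes; this file is topology and pays nothing
by itself.

## References
* [HarishChandra1970] Harish-Chandra (notes by G. van Dijk), *Harmonic Analysis on Reductive p-adic Groups*, LNM 162 (1970), Part I §3, Lemma 14.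
* [Rogawski1990] J. D. Rogawski, *Automorphic Representations of Unitary Groups in Three Variables*, Ann. of Math. Stud. 123 (1990), §4.9 p. 54; §3.1 p. 19.
* [PlatonovRapinchuk1994] V. Platonov, A. Rapinchuk, *Algebraic Groups and Number Theory* (1994), §5.1 (the one-place model of `U(J)(F_v)` at a non-split place).
-/

set_option autoImplicit false

noncomputable section

open Set Filter Topology NumberField IsDedekindDomain
open Literature.MeasureTheory.Group
open scoped Matrix MatrixGroups Pointwise

namespace Literature.NumberTheory.Automorphic

/-! ## §1 Generic transport along a group isomorphism -/

section Transport

variable {G G' : Type*} [Group G] [Group G'] (e : G ≃* G')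

/-- `e '' {x ∣ ∃ t ∈ K, x t x⁻¹ ∈ C} = {x' ∣ ∃ t' ∈ e '' K, x' t' x'⁻¹ ∈ e '' C}` for a group isomorphism `e`. [cite: HarishChandra1970, Part I §3 Lemma 14] -/
theorem image_setOf_exists_conj_mem_mulEquiv (K C : Set G) :
    e '' {x : G | ∃ t ∈ K, x * t * x⁻¹ ∈ C} = {x' : G' | ∃ t' ∈ e '' K, x' * t' * x'⁻¹ ∈ e '' C} := by
  ext x'
  constructor
  · rintro ⟨x, ⟨t, ht, hx⟩, rfl⟩
    exact ⟨e t, mem_image_of_mem e ht, by simpa only [map_mul, map_inv] using mem_image_of_mem e hx⟩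
  · rintro ⟨_, ⟨t, ht, rfl⟩, c, hc, hce⟩
    refine ⟨e.symm x', ⟨t, ht, ?_⟩, e.apply_symm_apply x'⟩
    have h : e (e.symm x' * t * (e.symm x')⁻¹) = e c := by rw [map_mul, map_mul, map_inv, e.apply_symm_apply, hce]
    rwa [e.injective h]

/-- The images in `G' ⧸ H'` and `G ⧸ H` correspond under ★ `cosetCongr e` (`H' = e H`). [cite: HarishChandra1970, Part I §3 Lemma 14] -/
theorem image_mk_setOf_exists_conj_mem_eq_image_cosetCongr (H : Subgroup G) (H' : Subgroup G') (hHH' : ∀ g, e g ∈ H' ↔ g ∈ H)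
    (K C : Set G) :
    (QuotientGroup.mk : G' → G' ⧸ H') '' {x' : G' | ∃ t' ∈ e '' K, x' * t' * x'⁻¹ ∈ e '' C} =
      cosetCongr e H H' hHH' '' ((QuotientGroup.mk : G → G ⧸ H) '' {x : G | ∃ t ∈ K, x * t * x⁻¹ ∈ C}) := by
  rw [← image_setOf_exists_conj_mem_mulEquiv e K C, Set.image_image, Set.image_image]
  refine Set.image_congr fun x _ => ?_
  rw [cosetCongr_mk]

variable [TopologicalSpace G] [TopologicalSpace G']

/-- **Compactness transport.**  If `e : G ≃* G'` is a homeomorphism and `H' = e H`, then `{ẋ ∈ G ⧸ H ∣ ∃ t ∈ K, x t x⁻¹ ∈ C}` is compact as soon as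
its image statement holds in `G' ⧸ H'` for `e K`, `e C` (★ `cosetCongrHomeomorph`). [cite: HarishChandra1970, Part I §3 Lemma 14] -/
theorem isCompact_image_mk_setOf_exists_conj_mem_of_mulEquiv (he : Continuous e) (hes : Continuous e.symm) (H : Subgroup G)
    (H' : Subgroup G') (hHH' : ∀ g, e g ∈ H' ↔ g ∈ H) {K C : Set G}
    (h : IsCompact ((QuotientGroup.mk : G' → G' ⧸ H') '' {x' : G' | ∃ t' ∈ e '' K, x' * t' * x'⁻¹ ∈ e '' C})) :
    IsCompact ((QuotientGroup.mk : G → G ⧸ H) '' {x : G | ∃ t ∈ K, x * t * x⁻¹ ∈ C}) := by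
  rw [image_mk_setOf_exists_conj_mem_eq_image_cosetCongr e H H' hHH', ← coe_cosetCongrHomeomorph e H H' hHH' he hes] at h
  exact (Homeomorph.isCompact_image _).1 h

end Transport

/-! ## §2 The local unitary groups `U(J)(F_v) = «local» E c N J v` at a non-split place -/

namespace UnitaryGroup

open Literature.NumberTheory.Rogawski1990 (IsRegularElt)

section Local

variable {F E : Type} [Field F] [NumberField F] [Field E] [NumberField E] [Algebra F E] [Algebra.IsQuadraticExtension F E]
  (c : E ≃ₐ[F] E) (N : ℕ) (J : Matrix (Fin N) (Fin N) E) {v : HeightOneSpectrum (𝓞 F)} (hc : c ≠ 1)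
  (hJ : (J.map c)ᵀ = J) (hJd : IsUnit J.det)

include hc hJ hJd in
/-- **HARISH-CHANDRA'S UNIFORM COMPACTNESS IN `U(J)(F_v)` AT A NON-SPLIT PLACE** (`w ∣ v`, `c • w = w`; `J` `c`-hermitian with unit determinant).  For
`γ ∈ U(J)(F_v)` regular semisimple, a compact `K ⊆ Z(γ)` of regular semisimple elements and a compact `C ⊆ U(J)(F_v)`:
`{ẋ ∈ U(J)(F_v) ⧸ Z(γ) ∣ ∃ t ∈ K, x t x⁻¹ ∈ C}` is COMPACT — ★ p840074's `U(σ_w, J_w)(E_w)` head through the one-place model ★ `localNonsplitEquiv` and §1.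
(= F0P3a-p03 (g10)'s (B1).) [cite: HarishChandra1970, Part I §3 Lemma 14] [cite: Rogawski1990, §4.9 p. 54; §3.1 p. 19] [cite: PlatonovRapinchuk1994, §5.1] -/
theorem isCompact_image_mk_setOf_exists_conj_mem_local_of_nonsplit (w : PlacesOver E v) (hw : c • w.1 = w.1)
    [LocallyCompactSpace (GL (Fin N) (w.1.adicCompletion E))] [SecondCountableTopology (GL (Fin N) (w.1.adicCompletion E))]
    (γ : «local» E c N J v) (hγ : IsRegularElt (γ : GL (Fin N) (LocalRing E v)))
    {K C : Set («local» E c N J v)} (hK : IsCompact K) (hKZ : K ⊆ Subgroup.centralizer ({γ} : Set («local» E c N J v)))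
    (hKreg : ∀ t ∈ K, IsRegularElt (t : GL (Fin N) (LocalRing E v))) (hC : IsCompact C) :
    IsCompact ((QuotientGroup.mk : «local» E c N J v → «local» E c N J v ⧸ Subgroup.centralizer ({γ} : Set («local» E c N J v))) ''
      {x | ∃ t ∈ K, x * t * x⁻¹ ∈ C}) := by
  letI : NontriviallyNormedField (w.1.adicCompletion E) :=
    Valued.toNontriviallyNormedField (w.1.adicCompletion E) (WithZero (Multiplicative ℤ))
  haveI : CharZero (w.1.adicCompletion E) := charZero_of_injective_algebraMap (algebraMap E (w.1.adicCompletion E)).injective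
  haveI : SigmaCompactSpace (GL (Fin N) (w.1.adicCompletion E)) := sigmaCompactSpace_of_locallyCompact_secondCountable
  set e := localNonsplitEquiv c J hc w hw with he_def
  have hσσ : ∀ x, galAdicCompletionMap (L := E) c hw (galAdicCompletionMap (L := E) c hw x) = x :=
    galAdicCompletionMap_galAdicCompletionMap_of_smul_eq c w hc hw
  have hJw : ((placeForm J w.1).map (galAdicCompletionMap (L := E) c hw))ᵀ = placeForm J w.1 :=
    placeForm_hermitian_of_smul_eq c w J hJ hw
  -- the head in `U(σ_w, J_w)(E_w)` for `e γ`, `e K`, `e C`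
  have hγ' := charpoly_separable_localNonsplitEquiv_of_isRegularElt c N J hc γ w hw hγ
  have hK' : IsCompact ((e : «local» E c N J v → _) '' K) := hK.image e.continuous
  have hC' : IsCompact ((e : «local» E c N J v → _) '' C) := hC.image e.continuous
  have hKZ' : (e : «local» E c N J v → _) '' K ⊆ Subgroup.centralizer ({e γ} : Set _) := by
    rintro _ ⟨t, ht, rfl⟩
    exact (forall_apply_mem_centralizer_singleton_iff_of_eq e.toMulEquiv rfl t).2 (hKZ ht)
  have hKreg' : ∀ t' ∈ (e : «local» E c N J v → _) '' K,
      (((t' : unitaryGroupOfForm (galAdicCompletionMap (L := E) c hw) (placeForm J w.1)) : GL (Fin N) (w.1.adicCompletion E)) :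
        Matrix (Fin N) (Fin N) (w.1.adicCompletion E)).charpoly.Separable := by
    rintro _ ⟨t, ht, rfl⟩
    exact charpoly_separable_localNonsplitEquiv_of_isRegularElt c N J hc t w hw (hKreg t ht)
  have h := UnitaryGroupOfForm.isCompact_image_mk_setOf_exists_conj_mem_of_charpoly_separable (m := N) two_ne_zero
    (continuous_galAdicCompletionMap E c hw) hσσ hJw
    ((Matrix.isUnit_iff_isUnit_det _).1 (isUnit_placeForm_of_isUnit_det hJd w.1)) (e γ) hγ' hK' hKZ' hKreg' hC'
  exact isCompact_image_mk_setOf_exists_conj_mem_of_mulEquiv e.toMulEquiv e.continuous e.symm.continuous _ _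
    (forall_apply_mem_centralizer_singleton_iff_of_eq e.toMulEquiv rfl) h

include hc hJ hJd in
/-- **The consumer's reading at `U(J)(F_v)`**: ONE compact `S ⊆ U(J)(F_v) ⧸ Z(γ)` carrying the support of every orbital integrand `ẋ ↦ f(x t x⁻¹)`,
`t ∈ K`, of every `f` supported in `C` (★ `support_descConj_subset_of_subset`; `Z(γ)` centralises `K` by `hKT`, e.g. ★
`centralizer_eq_centralizer_of_charpoly_separable` through the model). [cite: Rogawski1990, §4.9 p. 54] [cite: HarishChandra1970, Part I §3 Lemma 14] -/
theorem exists_isCompact_forall_support_descConj_subset_local_of_nonsplit (w : PlacesOver E v) (hw : c • w.1 = w.1)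
    [LocallyCompactSpace (GL (Fin N) (w.1.adicCompletion E))] [SecondCountableTopology (GL (Fin N) (w.1.adicCompletion E))]
    (γ : «local» E c N J v) (hγ : IsRegularElt (γ : GL (Fin N) (LocalRing E v)))
    {K C : Set («local» E c N J v)} (hK : IsCompact K) (hKZ : K ⊆ Subgroup.centralizer ({γ} : Set («local» E c N J v)))
    (hKreg : ∀ t ∈ K, IsRegularElt (t : GL (Fin N) (LocalRing E v))) (hC : IsCompact C)
    (hKT : ∀ t ∈ K, ∀ τ ∈ Subgroup.centralizer ({γ} : Set («local» E c N J v)), τ * t = t * τ) :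
    ∃ S : Set («local» E c N J v ⧸ Subgroup.centralizer ({γ} : Set («local» E c N J v))), IsCompact S ∧
      ∀ {β : Type*} [Zero β] (f : «local» E c N J v → β), Function.support f ⊆ C → ∀ t (ht : t ∈ K),
        Function.support (descConj t (Subgroup.centralizer ({γ} : Set («local» E c N J v))) (hKT t ht) f) ⊆ S :=
  ⟨_, isCompact_image_mk_setOf_exists_conj_mem_local_of_nonsplit c N J hc hJ hJd w hw γ hγ hK hKZ hKreg hC,
    fun _ hf _ ht => support_descConj_subset_of_subset _ hKT subset_rfl hf ht⟩

end Local

section CM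

variable (L : Type) [Field L] [NumberField L] [IsCMField L] (N : ℕ) (H : Matrix (Fin N) (Fin N) L)
  (hH : (H.map (cmConjRingHom L))ᵀ = H) (hHd : IsUnit H.det) {v : HeightOneSpectrum (𝓞 ↥(maximalRealSubfield L))}

include hH hHd in
/-- **The CM spelling**: `G′_v = (cmDatum L N H).Local v` (= `«local» L c N H v`, `c` = complex conjugation, definitionally), `H` hermitian with unit
determinant, `v` non-split (`w ∣ v`, `c • w = w`): `{ẋ ∈ G′_v ⧸ Z(γ) ∣ ∃ t ∈ K, x t x⁻¹ ∈ C}` is compact for `γ` regular semisimple, `K ⊆ Z(γ)` compact regular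
semisimple, `C` compact. [cite: Rogawski1990, §4.9 p. 54; §3.1 p. 19] [cite: HarishChandra1970, Part I §3 Lemma 14] -/
theorem isCompact_image_mk_setOf_exists_conj_mem_cmDatum_local (w : PlacesOver L v) (hw : IsCMField.complexConj L • w.1 = w.1)
    [LocallyCompactSpace (GL (Fin N) (w.1.adicCompletion L))] [SecondCountableTopology (GL (Fin N) (w.1.adicCompletion L))]
    (γ : (cmDatum L N H).Local v) (hγ : IsRegularElt (γ.val : GL (Fin N) (LocalRing L v)))
    {K C : Set ((cmDatum L N H).Local v)} (hK : IsCompact K) (hKZ : K ⊆ Subgroup.centralizer ({γ} : Set ((cmDatum L N H).Local v)))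
    (hKreg : ∀ t ∈ K, IsRegularElt (t.val : GL (Fin N) (LocalRing L v))) (hC : IsCompact C) :
    IsCompact ((QuotientGroup.mk : (cmDatum L N H).Local v → (cmDatum L N H).Local v ⧸ Subgroup.centralizer ({γ} : Set ((cmDatum L N H).Local v))) ''
      {x | ∃ t ∈ K, x * t * x⁻¹ ∈ C}) :=
  isCompact_image_mk_setOf_exists_conj_mem_local_of_nonsplit (IsCMField.complexConj L) N H (IsCMField.complexConj_ne_one L)
    (by rw [← map_cmConjRingHom_eq_map_complexConj L H]; exact hH) hHd w hw γ hγ hK hKZ hKreg hC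

end CM

end UnitaryGroup

end Literature.NumberTheory.Automorphic

end
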